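import Summits.QuantumFields.YangMills.Theorems.TwistedTraceScaling.Negative.VacuumFloorLedger
import HarnessLib

/-!
# R14 (crux `TwistedTraceScaling`, stmt-QuantumFields-20203): with the IDEAL normalisation `Λ_id = N_free·e^{−6Z₀(L)}` of lane A's own floor (gen 10 plan F6/F7),
# the comparison `N_B·e^{−6Z₀} ≤ Λ·e^{o(β^{−p})}` is FALSE at EVERY `L ≥ 1` unless `m > 2p` AND `3r > 1 + 3m + p` — the full exponent ledger,
# which the free ceiling only saw at `L = 1` (R13), is NECESSARY for `…FloorNormalisation` at every `L`

Standing disprover `ym-cdisprove-20203-1` (gen 13), sequel to `…Negative.ValleyFloorLedger` (R13, p591007) and `…Negative.VacuumFloorLedger` (R13b, p591655).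
Lane A's generation 10 (HANDOFF-g10, COARSE-DESIGN §18) reverses §17.10 and builds the k = 0 floor itself: target `VacuumFloorAt L Λ_id tol` with the IDEAL
normalisation `Λ_id(β) := (2π²)^{−|E|}·e^{2β|E|}·√(π/β)^{3|E|}·e^{−6·toronZPE L (1/2) 0 0} = N_free(β)·e^{−6Z₀(L)}`, `tol = β^{−c}`, followed by the normalisation
comparison (plan item F7) `N_B·e^{−6Z₀} ≤ Λ_id·e^{o(β^{−p})}` and ★★★★ `COARSE-UPPER(L) ⇐ InnerNoIntruderOneOrbitAt` alone, through
`coarseNoIntruderAt_of_vacuumFloor_pow` (p590973) at `Λ := Λ_id`.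
R13 showed the comparison input `hcmp` of that theorem unsatisfiable for EVERY floor `(Λ, tol)` when `3r < 1 + 3m` (every `L`) and at `L = 1` when
`m ≤ 2p ∨ 3r ≤ 1 + 3m + p`; at `L ≥ 2` the window `1 + 3m ≤ 3r ≤ 1 + 3m + p` and the line `m ≤ 2p` were invisible to the free ceiling because of its slack `e^{6Z₀(L)}`.
For the floors lane A will actually produce — ANY `Λ` within `e^{o(β^{−p})}` of `Λ_id`, in particular `Λ_id` itself — there is NO slack, and the `6Z₀` cancels:
* ★ `comparison_false_near_ideal (L) (hr : 0 ≤ r) (hm : 0 ≤ m) (h : m ≤ 2p ∨ 3r ≤ 1 + 3m + p) (hΛ : ∀ a > 0, eventually Λ ≤ N_free·e^{−6Z₀}·e^{a·β^{−p}})` :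
  `¬ ∀ ε > 0, eventually N_B·e^{−6Z₀} ≤ Λ·e^{ε·β^{−p}}` — EVERY `L ≥ 1`, every `q` (`N_B β = riccatiN L β β^{−r} (2β^{−q}) β^{−m}`): `hcmp` at `(a, ε) = (1/4, 1/4)` and
  `riccatiN_ge` force `trialErr + 3|E|·modeZPE((β/2)μ/b') ≤ β^{−p}/2`, killed by `3|E|·modeZPE ≥ (3/4)β^{−m/2}` (`m ≤ 2p`) or by `trialErr ≥ β^{1+3m−3r}` (`3r ≤ 1 + 3m + p`);
* ★ `idealFloor_comparison_false (L) (hr) (hm) (h)` — the case `Λ = Λ_id` (lane A's F7 text): FALSE off the full ledger at every `L`;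
* ★ `no_idealFloor_handover (L) (hr) (hm) (h)` — hence at `Λ := Λ_id` the inputs `(hV, htol, hcmp)` of `coarseNoIntruderAt_of_vacuumFloor_pow` are jointly
  unsatisfiable for every `tol` whenever `m ≤ 2p ∨ 3r ≤ 1 + 3m + p`: the END-TO-END theorem of plan item F7 must carry `2p < m` and `1 + 3m + p < 3r` as hypotheses
  at every `L` (R13's `floor_ledger_window` then gives `q > 2/3 + 5p`, `r > 1/3 + p`… on top of `2r < q − m/2`);
* `ideal_ledger_examples` — at `p = 1/40`: `(r, m) = (0.39, 0.055)` (`3r = 1.17`, inside R13's blind window `(1.165, 1.19]`) and `m = 0.05 = 2p` are killed at EVERY `L`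
  for `Λ_id`; the point of record `(0.41, 0.055)` passes (`1.23 > 1.19`, `0.055 > 0.05`).
* §4 `idealFloor_handover_window` / `idealFloor_handover_window_of_comparison` — the WINDOW of the ★★★★ hand-over through `Λ_id`: the necessary ledger
  together with the typed `2r < q − m/2`, `q < 8/9` of `coarseNoIntruderAt_of_vacuumFloor_pow` confines the exponents to `p < 2/51 ≈ 0.039`, `2/3 + 17p/3 < q < 8/9`,
  `(1 + 7p)/3 < r < 4/9 − p/2`, `2p < m < 4/45 − 4p/15` (the typed form of COARSE-DESIGN §17.7's `q > 2/3 + 17p/3`); at the corner `p = 2/51` the comparison is refuted on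
  the whole typed range (`idealFloor_comparison_false_corner`); the point of record `(1/40, 0.85, 0.41, 0.055)` sits inside (`q > 0.808`, `0.392 < r < 0.432`, `m < 0.0822`).
READING.  Nothing here bounds `λ₀`: the statements compare two EXPLICIT normalisations.  Lane A's switch from lane B's untyped `Λ_B` to `Λ_id` makes the full ledger
`m > 2p ∧ 3r > 1 + 3m + p` a hypothesis of F7 at every `L`, not only at `L = 1`; the point of record passes with the same thin margins as in COARSE-DESIGN §17.7.
NO KILL of the crux, of `VacuumFloorAt L Λ_id (β^{−c})` (plausible for `c < 1/3`; the toron quartic zero-point energy `≍ β^{−1/3}/L` is a genuine deficit below `Λ_id`,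
so `c > 1/3` would be false — not certifiable with tree facts, it is lane A's UPPER content), or of F7 on the ledger.
HONEST FRAMING: fixed-lattice `SU(2)` bookkeeping about a typed input (`hcmp` at `Λ_id`) of a stub lane (S-BASE C3d) of a child of the CONDITIONAL reduction
route (femto rung R2b1); not `¬TwistedTraceScaling`, not infinite volume, not a gap, not Clay.  Sorry-free, no new definition; axioms ⊆ {propext, Classical.choice, Quot.sound}.
-/

set_option autoImplicit false

noncomputable section

open Real
open Literature.MathematicalPhysics.QuantumFieldTheory
open Literature.MathematicalPhysics.QuantumLattice
open Summit.QuantumFields.YangMills.Theorems.FemtoTransferGap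
open Summit.QuantumFields.YangMills.Theorems.FemtoTransferGap.TwoLattice
open Summit.QuantumFields.YangMills.Theorems.FemtoTransferGap.TwoLattice.Toron
open Summit.QuantumFields.YangMills.Theorems.FemtoTransferGap.TwoLattice.Cov

namespace Summit.QuantumFields.YangMills.Theorems.TwistedTraceScaling.Negative.R14

/-! ## §1 ★ Near the ideal normalisation the comparison forces the full ledger at every `L` -/

/-- **The comparison with a near-ideal `Λ` bounds the loaded exponents** (every `L ≥ 1`; scales `ρ(β) ≥ 0`): if eventually
`Λ ≤ N_free·e^{−6Z₀}·e^{a·δ}` for every `a > 0` and eventually `N_B·e^{−6Z₀} ≤ Λ·e^{ε·δ}` for every `ε > 0`, then for every `ε > 0`, eventually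
`trialErr(…) + 3|E|·modeZPE((β/2)μ/b') ≤ ε·δ(β)` — the `6Z₀(L)` and `N_free` cancel (`riccatiN_ge`). [cite: Luscher1983, §3] -/
theorem loaded_exponents_le_of_comparison (L : ℕ) [NeZero L] {δ ρ σ μ Λ : ℝ → ℝ} (hρ : ∀ β, 0 ≤ ρ β)
    (hΛ : ∀ a : ℝ, 0 < a → ∃ β0 : ℝ, ∀ β : ℝ, β0 ≤ β →
      Λ β ≤ (Real.exp (2 * β) * Real.sqrt (π / β) ^ 3 / (2 * π ^ 2)) ^ Fintype.card (Edge 3 L) *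
        Real.exp (-(6 * toronZPE L (1 / 2) 0 0)) * Real.exp (a * δ β))
    (hcmp : ∀ ε : ℝ, 0 < ε → ∃ β0 : ℝ, ∀ β : ℝ, β0 ≤ β →
      riccatiN L β (ρ β) (σ β) (μ β) * Real.exp (-(6 * toronZPE L (1 / 2) 0 0)) ≤ Λ β * Real.exp (ε * δ β)) :
    ∀ ε : ℝ, 0 < ε → ∃ β0 : ℝ, ∀ β : ℝ, β0 ≤ β →
      trialErr (ρ β) (σ β) (Fintype.card (Plaquette 3 L × Fin 3)) (Fintype.card (Edge 3 L × Fin 3))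
          (Real.sqrt ((β / 2) ^ 2 + 2 * (β / 2) * (β / (1 + ρ β ^ 2) ^ 2) / μ β) / μ β)
          (Real.sqrt ((β / 2) ^ 2 + 2 * (β / 2) * (β / (1 + ρ β ^ 2) ^ 2) / μ β))
          (3 * (β / 2) / μ β ^ 2 + 3 * (β / (1 + ρ β ^ 2) ^ 2) / μ β ^ 3) +
        ((Fintype.card (Edge 3 L) * 3 : ℕ) : ℝ) * modeZPE (β / 2 * μ β / (β / (1 + ρ β ^ 2) ^ 2)) ≤ ε * δ β := by
  intro ε hε
  obtain ⟨βa, hβa⟩ := hΛ (ε / 2) (by positivity)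
  obtain ⟨βc, hβc⟩ := hcmp (ε / 2) (by positivity)
  refine ⟨max (max βa βc) 1, fun β hβ => ?_⟩
  have hβ1 : 1 ≤ β := (le_max_right _ _).trans hβ
  have hβpos : 0 < β := by linarith
  have hA := hβa β (((le_max_left _ _).trans (le_max_left _ _)).trans hβ)
  have hC := hβc β (((le_max_right _ _).trans (le_max_left _ _)).trans hβ)
  have hlow := R13.riccatiN_ge L (σ β) (μ β) hβpos (hρ β)
  set Nf := (Real.exp (2 * β) * Real.sqrt (π / β) ^ 3 / (2 * π ^ 2)) ^ Fintype.card (Edge 3 L) with hNf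
  have hNf0 : 0 < Nf := by positivity
  set T := trialErr (ρ β) (σ β) (Fintype.card (Plaquette 3 L × Fin 3)) (Fintype.card (Edge 3 L × Fin 3))
          (Real.sqrt ((β / 2) ^ 2 + 2 * (β / 2) * (β / (1 + ρ β ^ 2) ^ 2) / μ β) / μ β)
          (Real.sqrt ((β / 2) ^ 2 + 2 * (β / 2) * (β / (1 + ρ β ^ 2) ^ 2) / μ β))
          (3 * (β / 2) / μ β ^ 2 + 3 * (β / (1 + ρ β ^ 2) ^ 2) / μ β ^ 3) with hT
  set Zn := ((Fintype.card (Edge 3 L) * 3 : ℕ) : ℝ) * modeZPE (β / 2 * μ β / (β / (1 + ρ β ^ 2) ^ 2)) with hZn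
  set Z := toronZPE L (1 / 2) 0 0 with hZ
  -- chain: `Nf e^T e^Zn e^{−6Z} ≤ N_B e^{−6Z} ≤ Λ e^{εδ/2} ≤ Nf e^{−6Z} e^{εδ/2} e^{εδ/2}`
  have hchain : Nf * Real.exp T * Real.exp Zn * Real.exp (-(6 * Z)) ≤
      Nf * Real.exp (-(6 * Z)) * Real.exp (ε / 2 * δ β) * Real.exp (ε / 2 * δ β) :=
    calc Nf * Real.exp T * Real.exp Zn * Real.exp (-(6 * Z))
        ≤ riccatiN L β (ρ β) (σ β) (μ β) * Real.exp (-(6 * Z)) := mul_le_mul_of_nonneg_right hlow (Real.exp_pos _).le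
      _ ≤ Λ β * Real.exp (ε / 2 * δ β) := hC
      _ ≤ Nf * Real.exp (-(6 * Z)) * Real.exp (ε / 2 * δ β) * Real.exp (ε / 2 * δ β) :=
          mul_le_mul_of_nonneg_right hA (Real.exp_pos _).le
  have h2 : Nf * (Real.exp T * Real.exp Zn * Real.exp (-(6 * Z))) ≤
      Nf * (Real.exp (-(6 * Z)) * Real.exp (ε / 2 * δ β) * Real.exp (ε / 2 * δ β)) :=
    le_of_eq_of_le (by ring) (hchain.trans_eq (by ring))
  have h3 := le_of_mul_le_mul_left h2 hNf0
  rw [← Real.exp_add, ← Real.exp_add, ← Real.exp_add, ← Real.exp_add, Real.exp_le_exp] at h3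
  linarith

/-- ★ **THE COMPARISON WITH ANY NEAR-IDEAL FLOOR IS FALSE OFF THE FULL LEDGER, AT EVERY `L ≥ 1`** (`r, m ≥ 0`, any real `p, q`):
if `Λ(β) ≤ N_free(β)·e^{−6Z₀(L)}·e^{a·β^{−p}}` eventually for every `a > 0` (e.g. `Λ = Λ_id`), and `m ≤ 2p` or `3r ≤ 1 + 3m + p`, then
`¬ ∀ ε > 0, eventually riccatiN L β β^{−r} (2β^{−q}) β^{−m} · e^{−6Z₀(L)} ≤ Λ(β)·e^{ε·β^{−p}}`.
Proof: `loaded_exponents_le_of_comparison` at `ε = 1/2` gives `trialErr + 3|E|·modeZPE((β/2)μ/b') ≤ β^{−p}/2`, while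
`3|E|·modeZPE ≥ (3/4)·β^{−m/2} ≥ (3/4)β^{−p}` if `m ≤ 2p` and `trialErr ≥ β^{1+3m−3r} ≥ β^{−p}` if `3r ≤ 1 + 3m + p`. [cite: Luscher1983, §3] -/
theorem comparison_false_near_ideal (L : ℕ) [NeZero L] {p q r m : ℝ} (hr : 0 ≤ r) (hm : 0 ≤ m) (h : m ≤ 2 * p ∨ 3 * r ≤ 1 + 3 * m + p)
    {Λ : ℝ → ℝ}
    (hΛ : ∀ a : ℝ, 0 < a → ∃ β0 : ℝ, ∀ β : ℝ, β0 ≤ β →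
      Λ β ≤ (Real.exp (2 * β) * Real.sqrt (π / β) ^ 3 / (2 * π ^ 2)) ^ Fintype.card (Edge 3 L) *
        Real.exp (-(6 * toronZPE L (1 / 2) 0 0)) * Real.exp (a * powScale p β)) :
    ¬ ∀ ε : ℝ, 0 < ε → ∃ β0 : ℝ, ∀ β : ℝ, β0 ≤ β →
      riccatiN L β (powScale r β) (2 * powScale q β) (powScale m β) * Real.exp (-(6 * toronZPE L (1 / 2) 0 0)) ≤
        Λ β * Real.exp (ε * powScale p β) := by
  intro hcmp
  obtain ⟨β0, hβ0⟩ := loaded_exponents_le_of_comparison L (δ := powScale p) (ρ := powScale r)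
    (σ := fun β => 2 * powScale q β) (μ := powScale m) (fun β => (powScale_pos r β).le) hΛ hcmp (1 / 2) (by norm_num)
  set β := max β0 1 with hβdef
  have hβ1' : 1 ≤ β := le_max_right _ _
  have hβpos : 0 < β := by linarith
  have hE := hβ0 β (le_max_left _ _)
  simp only [powScale_eq hβ1'] at hE
  obtain ⟨hN1, hn1, h3⟩ := R13.one_le_cards L
  set N : ℝ := (Fintype.card (Plaquette 3 L × Fin 3) : ℝ) with hN
  set n : ℝ := (Fintype.card (Edge 3 L × Fin 3) : ℝ) with hn
  set ρ := β ^ (-r) with hρ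
  set μ := β ^ (-m) with hμ
  have hρ0 : 0 ≤ ρ := (Real.rpow_pos_of_pos hβpos _).le
  have hρ1 : ρ ≤ 1 := Real.rpow_le_one_of_one_le_of_nonpos hβ1' (by linarith)
  have hμ0 : 0 < μ := Real.rpow_pos_of_pos hβpos _
  have hμ1 : μ ≤ 1 := Real.rpow_le_one_of_one_le_of_nonpos hβ1' (by linarith)
  have hpp : 0 < β ^ (-p) := Real.rpow_pos_of_pos hβpos _
  -- the ZPE exponent: `modeZPE((β/2)μ/b') ≥ modeZPE(μ/2) ≥ √μ/4 = β^{−m/2}/4`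
  have hy : μ / 2 ≤ β / 2 * μ / (β / (1 + ρ ^ 2) ^ 2) := by
    rw [show β / 2 * μ / (β / (1 + ρ ^ 2) ^ 2) = μ / 2 * (1 + ρ ^ 2) ^ 2 by field_simp]
    have : 1 ≤ (1 + ρ ^ 2) ^ 2 := by nlinarith [sq_nonneg ρ]
    nlinarith [hμ0.le]
  have hZ1 : Real.sqrt μ / 4 ≤ modeZPE (β / 2 * μ / (β / (1 + ρ ^ 2) ^ 2)) := by
    have h1 := R13.modeZPE_ge (y := μ / 2) (by positivity) (by linarith)
    rw [show 2 * (μ / 2) = μ by ring] at h1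
    exact h1.trans (modeZPE_le_modeZPE (by positivity) hy)
  have hsμ : Real.sqrt μ = β ^ (-(m / 2)) := by
    rw [hμ, Real.sqrt_eq_rpow, ← Real.rpow_mul hβpos.le]; congr 1; ring
  have hZn : 3 * (β ^ (-(m / 2)) / 4) ≤ ((Fintype.card (Edge 3 L) * 3 : ℕ) : ℝ) * modeZPE (β / 2 * μ / (β / (1 + ρ ^ 2) ^ 2)) := by
    rw [← hsμ]
    have h0 : 0 ≤ Real.sqrt μ / 4 := by positivity
    calc 3 * (Real.sqrt μ / 4) ≤ ((Fintype.card (Edge 3 L) * 3 : ℕ) : ℝ) * (Real.sqrt μ / 4) := mul_le_mul_of_nonneg_right h3 h0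
      _ ≤ _ := mul_le_mul_of_nonneg_left hZ1 (by positivity)
  -- the trial exponent: `trialErr ≥ β^{1+3m−3r}`
  have hT := R13.trialErr_ge (σ := 2 * β ^ (-q)) (n := n)
    (m := Real.sqrt ((β / 2) ^ 2 + 2 * (β / 2) * (β / (1 + ρ ^ 2) ^ 2) / μ) / μ)
    (m₁ := Real.sqrt ((β / 2) ^ 2 + 2 * (β / 2) * (β / (1 + ρ ^ 2) ^ 2) / μ))
    (Lc := 3 * (β / 2) / μ ^ 2 + 3 * (β / (1 + ρ ^ 2) ^ 2) / μ ^ 3) hρ0 (by positivity : (0 : ℝ) ≤ N) (by positivity)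
    (Real.sqrt_nonneg _) (by positivity)
  have hb' : β / 4 ≤ β / (1 + ρ ^ 2) ^ 2 := by
    rw [div_le_div_iff₀ (by norm_num) (by positivity)]
    have hρ2 : ρ ^ 2 ≤ 1 := by rw [sq]; exact mul_le_one₀ hρ1 hρ0 hρ1
    have h4 : (1 + ρ ^ 2) ^ 2 ≤ (1 + 1) ^ 2 := pow_le_pow_left₀ (by positivity) (by linarith) 2
    nlinarith
  have hLc : β / μ ^ 3 ≤ 4 / 3 * (3 * (β / 2) / μ ^ 2 + 3 * (β / (1 + ρ ^ 2) ^ 2) / μ ^ 3) := by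
    have h1 : 0 ≤ 3 * (β / 2) / μ ^ 2 := by positivity
    have h2 : β / μ ^ 3 ≤ 4 / 3 * (3 * (β / (1 + ρ ^ 2) ^ 2) / μ ^ 3) := by
      rw [show 4 / 3 * (3 * (β / (1 + ρ ^ 2) ^ 2) / μ ^ 3) = 4 * (β / (1 + ρ ^ 2) ^ 2) / μ ^ 3 by ring]
      exact div_le_div_of_nonneg_right (by linarith) (by positivity)
    nlinarith
  have hid : ρ ^ 3 * (β / μ ^ 3) = β ^ (1 + 3 * m - 3 * r) := by rw [hρ, hμ]; exact R13.rpow_ledger r m hβpos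
  have hN3 : 1 ≤ N ^ 3 := one_le_pow₀ hN1
  have hsn : 1 ≤ Real.sqrt n := Real.one_le_sqrt.mpr hn1
  have hmain : β ^ (1 + 3 * m - 3 * r) ≤
      100800000 * ρ ^ 3 * N ^ 3 * Real.sqrt n * (3 * (β / 2) / μ ^ 2 + 3 * (β / (1 + ρ ^ 2) ^ 2) / μ ^ 3) := by
    have hL0 : 0 ≤ 3 * (β / 2) / μ ^ 2 + 3 * (β / (1 + ρ ^ 2) ^ 2) / μ ^ 3 := by positivity
    calc β ^ (1 + 3 * m - 3 * r) = ρ ^ 3 * (β / μ ^ 3) := hid.symm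
      _ ≤ ρ ^ 3 * (4 / 3 * (3 * (β / 2) / μ ^ 2 + 3 * (β / (1 + ρ ^ 2) ^ 2) / μ ^ 3)) := mul_le_mul_of_nonneg_left hLc (by positivity)
      _ = 4 / 3 * ρ ^ 3 * 1 * 1 * (3 * (β / 2) / μ ^ 2 + 3 * (β / (1 + ρ ^ 2) ^ 2) / μ ^ 3) := by ring
      _ ≤ 100800000 * ρ ^ 3 * N ^ 3 * Real.sqrt n * (3 * (β / 2) / μ ^ 2 + 3 * (β / (1 + ρ ^ 2) ^ 2) / μ ^ 3) := by
          gcongr; norm_num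
  have hT0 : 0 ≤ 100800000 * ρ ^ 3 * N ^ 3 * Real.sqrt n * (3 * (β / 2) / μ ^ 2 + 3 * (β / (1 + ρ ^ 2) ^ 2) / μ ^ 3) := by
    positivity
  rcases h with hmp | hrp
  · -- `m ≤ 2p`: `β^{−m/2} ≥ β^{−p}`
    have h1 : β ^ (-p) ≤ β ^ (-(m / 2)) := Real.rpow_le_rpow_of_exponent_le hβ1' (by linarith)
    linarith
  · -- `3r ≤ 1 + 3m + p`: `β^{1+3m−3r} ≥ β^{−p}`
    have h1 : β ^ (-p) ≤ β ^ (1 + 3 * m - 3 * r) := Real.rpow_le_rpow_of_exponent_le hβ1' (by linarith)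
    have h2 : 0 < β ^ (-(m / 2)) := Real.rpow_pos_of_pos hβpos _
    linarith

/-! ## §2 ★ Lane A's F7 text: the ideal normalisation `Λ_id = N_free·e^{−6Z₀}` -/

/-- ★ **F7 WITH `Λ_id` IS FALSE OFF THE FULL LEDGER AT EVERY `L ≥ 1`** (`r, m ≥ 0`; any real `p, q`): with
`Λ_id(β) = (e^{2β}√(π/β)³/(2π²))^{|E|}·e^{−6·toronZPE L (1/2) 0 0}`, if `m ≤ 2p` or `3r ≤ 1 + 3m + p` then
`¬ ∀ ε > 0, eventually N_B(β)·e^{−6Z₀} ≤ Λ_id(β)·e^{ε·β^{−p}}` (`N_B β = riccatiN L β β^{−r} (2β^{−q}) β^{−m}`). [cite: Luscher1983, §3] -/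
theorem idealFloor_comparison_false (L : ℕ) [NeZero L] {p q r m : ℝ} (hr : 0 ≤ r) (hm : 0 ≤ m) (h : m ≤ 2 * p ∨ 3 * r ≤ 1 + 3 * m + p) :
    ¬ ∀ ε : ℝ, 0 < ε → ∃ β0 : ℝ, ∀ β : ℝ, β0 ≤ β →
      riccatiN L β (powScale r β) (2 * powScale q β) (powScale m β) * Real.exp (-(6 * toronZPE L (1 / 2) 0 0)) ≤
        ((Real.exp (2 * β) * Real.sqrt (π / β) ^ 3 / (2 * π ^ 2)) ^ Fintype.card (Edge 3 L) *
            Real.exp (-(6 * toronZPE L (1 / 2) 0 0))) * Real.exp (ε * powScale p β) := by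
  refine comparison_false_near_ideal L (q := q) hr hm h (Λ := fun β =>
    (Real.exp (2 * β) * Real.sqrt (π / β) ^ 3 / (2 * π ^ 2)) ^ Fintype.card (Edge 3 L) * Real.exp (-(6 * toronZPE L (1 / 2) 0 0))) ?_
  intro a ha
  refine ⟨1, fun β _ => ?_⟩
  have h1 : 1 ≤ Real.exp (a * powScale p β) := Real.one_le_exp (mul_nonneg ha.le (powScale_pos p β).le)
  have h0 : 0 ≤ (Real.exp (2 * β) * Real.sqrt (π / β) ^ 3 / (2 * π ^ 2)) ^ Fintype.card (Edge 3 L) *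
      Real.exp (-(6 * toronZPE L (1 / 2) 0 0)) := by positivity
  simpa using mul_le_mul_of_nonneg_left h1 h0

/-- ★ **NO HAND-OVER THROUGH `Λ_id` OFF THE LEDGER**: for `r, m ≥ 0` and `m ≤ 2p ∨ 3r ≤ 1 + 3m + p` (every `L ≥ 1`, every `q`) there is no `tol` with
`VacuumFloorAt L Λ_id tol`, `tol = o(β^{−p})` and the comparison `N_B·e^{−6Z₀} ≤ Λ_id·e^{o(β^{−p})}` — the inputs `(hV, htol, hcmp)` of
`coarseNoIntruderAt_of_vacuumFloor_pow` at `Λ := Λ_id` are jointly unsatisfiable there (already `hcmp` alone is). [cite: Luscher1983, §3] -/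
theorem no_idealFloor_handover (L : ℕ) [NeZero L] {p q r m : ℝ} (hr : 0 ≤ r) (hm : 0 ≤ m) (h : m ≤ 2 * p ∨ 3 * r ≤ 1 + 3 * m + p) :
    ¬ ∃ tol : ℝ → ℝ,
      VacuumFloorAt L (fun β => (Real.exp (2 * β) * Real.sqrt (π / β) ^ 3 / (2 * π ^ 2)) ^ Fintype.card (Edge 3 L) *
          Real.exp (-(6 * toronZPE L (1 / 2) 0 0))) tol ∧
        (∀ ε : ℝ, 0 < ε → ∃ β0 : ℝ, ∀ β : ℝ, β0 ≤ β → tol β ≤ ε * powScale p β) ∧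
        (∀ ε : ℝ, 0 < ε → ∃ β0 : ℝ, ∀ β : ℝ, β0 ≤ β →
          riccatiN L β (powScale r β) (2 * powScale q β) (powScale m β) * Real.exp (-(6 * toronZPE L (1 / 2) 0 0)) ≤
            ((Real.exp (2 * β) * Real.sqrt (π / β) ^ 3 / (2 * π ^ 2)) ^ Fintype.card (Edge 3 L) *
                Real.exp (-(6 * toronZPE L (1 / 2) 0 0))) * Real.exp (ε * powScale p β)) := by
  rintro ⟨tol, -, -, hcmp⟩
  exact idealFloor_comparison_false L hr hm h hcmp

/-- **Contrapositive for lane A's F7**: if the comparison with `Λ_id` holds at some `L ≥ 1` (for `r, m ≥ 0`), then `2p < m` and `1 + 3m + p < 3r`. [cite: Luscher1983, §3] -/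
theorem ledger_of_idealFloor_comparison (L : ℕ) [NeZero L] {p q r m : ℝ} (hr : 0 ≤ r) (hm : 0 ≤ m)
    (hcmp : ∀ ε : ℝ, 0 < ε → ∃ β0 : ℝ, ∀ β : ℝ, β0 ≤ β →
      riccatiN L β (powScale r β) (2 * powScale q β) (powScale m β) * Real.exp (-(6 * toronZPE L (1 / 2) 0 0)) ≤
        ((Real.exp (2 * β) * Real.sqrt (π / β) ^ 3 / (2 * π ^ 2)) ^ Fintype.card (Edge 3 L) *
            Real.exp (-(6 * toronZPE L (1 / 2) 0 0))) * Real.exp (ε * powScale p β)) :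
    2 * p < m ∧ 1 + 3 * m + p < 3 * r := by
  by_contra hneg
  have h : m ≤ 2 * p ∨ 3 * r ≤ 1 + 3 * m + p := by
    rcases not_and_or.mp hneg with h1 | h1
    · exact Or.inl (not_lt.mp h1)
    · exact Or.inr (not_lt.mp h1)
  exact idealFloor_comparison_false L hr hm h hcmp

/-! ## §3 Examples: R13's blind window at `L ≥ 2` is now closed for `Λ_id`; the point of record passes -/

/-- At `p = 1/40`, for EVERY `L ≥ 1` and every `q`: the F7 comparison with `Λ_id` is refuted at `(r, m) = (0.39, 0.055)` (`3r = 1.17 ≤ 1.19`; R13's every-`L`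
theorem needed `3r < 1.165`) and at `m = 0.05 = 2p` (any `r ≥ 0`); the point of record `(r, m) = (0.41, 0.055)` satisfies both necessary conditions. -/
theorem ideal_ledger_examples (L : ℕ) [NeZero L] (q r : ℝ) (hr : 0 ≤ r) :
    (¬ ∀ ε : ℝ, 0 < ε → ∃ β0 : ℝ, ∀ β : ℝ, β0 ≤ β →
        riccatiN L β (powScale 0.39 β) (2 * powScale q β) (powScale 0.055 β) * Real.exp (-(6 * toronZPE L (1 / 2) 0 0)) ≤
          ((Real.exp (2 * β) * Real.sqrt (π / β) ^ 3 / (2 * π ^ 2)) ^ Fintype.card (Edge 3 L) *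
              Real.exp (-(6 * toronZPE L (1 / 2) 0 0))) * Real.exp (ε * powScale (1 / 40) β)) ∧
      (¬ ∀ ε : ℝ, 0 < ε → ∃ β0 : ℝ, ∀ β : ℝ, β0 ≤ β →
        riccatiN L β (powScale r β) (2 * powScale q β) (powScale 0.05 β) * Real.exp (-(6 * toronZPE L (1 / 2) 0 0)) ≤
          ((Real.exp (2 * β) * Real.sqrt (π / β) ^ 3 / (2 * π ^ 2)) ^ Fintype.card (Edge 3 L) *
              Real.exp (-(6 * toronZPE L (1 / 2) 0 0))) * Real.exp (ε * powScale (1 / 40) β)) ∧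
      ((2 : ℝ) * (1 / 40) < 0.055 ∧ (1 : ℝ) + 3 * 0.055 + 1 / 40 < 3 * 0.41 ∧ (1 : ℝ) + 3 * 0.055 < 3 * 0.39) :=
  ⟨idealFloor_comparison_false L (by norm_num) (by norm_num) (Or.inr (by norm_num)),
    idealFloor_comparison_false L hr (by norm_num) (Or.inl (by norm_num)), by norm_num⟩

/-! ## §4 The window of the ★★★★ hand-over through `Λ_id` (plan item F7 inside `coarseNoIntruderAt_of_vacuumFloor_pow`'s typed range) -/

/-- **Window.**  The necessary ledger `2p < m ∧ 1 + 3m + p < 3r` (§2) together with the typed `2r < q − m/2` and `q < 8/9` of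
`coarseNoIntruderAt_of_vacuumFloor_pow` confines the exponents to `p < 2/51`, `2/3 + 17p/3 < q`, `(1 + 7p)/3 < r < 4/9 − p/2`, `m < 4/45 − 4p/15`:
the ★★★★ theorem of plan item F7 can only be stated for `0 < p < 2/51 ≈ 0.039` (linear bookkeeping). [folklore] -/
theorem idealFloor_handover_window {p q r m : ℝ} (hq : q < 8 / 9) (hrq : 2 * r < q - m / 2) (hL : 2 * p < m ∧ 1 + 3 * m + p < 3 * r) :
    p < 2 / 51 ∧ 2 / 3 + 17 * p / 3 < q ∧ (1 + 7 * p) / 3 < r ∧ r < 4 / 9 - p / 2 ∧ m < 4 / 45 - 4 * p / 15 := by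
  obtain ⟨h1, h2⟩ := hL
  refine ⟨by linarith, by linarith, by linarith, by linarith, by linarith⟩

/-- **Window, from the comparison** (every `L ≥ 1`): inside the typed range (`0 ≤ r`, `0 ≤ m`, `2r < q − m/2`, `q < 8/9`) the F7 comparison with `Λ_id`
forces `p < 2/51 ∧ 2/3 + 17p/3 < q ∧ (1 + 7p)/3 < r < 4/9 − p/2 ∧ m < 4/45 − 4p/15`. [cite: Luscher1983, §3] -/
theorem idealFloor_handover_window_of_comparison (L : ℕ) [NeZero L] {p q r m : ℝ} (hr : 0 ≤ r) (hm : 0 ≤ m)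
    (hrq : 2 * r < q - m / 2) (hq : q < 8 / 9)
    (hcmp : ∀ ε : ℝ, 0 < ε → ∃ β0 : ℝ, ∀ β : ℝ, β0 ≤ β →
      riccatiN L β (powScale r β) (2 * powScale q β) (powScale m β) * Real.exp (-(6 * toronZPE L (1 / 2) 0 0)) ≤
        ((Real.exp (2 * β) * Real.sqrt (π / β) ^ 3 / (2 * π ^ 2)) ^ Fintype.card (Edge 3 L) *
            Real.exp (-(6 * toronZPE L (1 / 2) 0 0))) * Real.exp (ε * powScale p β)) :
    p < 2 / 51 ∧ 2 / 3 + 17 * p / 3 < q ∧ (1 + 7 * p) / 3 < r ∧ r < 4 / 9 - p / 2 ∧ m < 4 / 45 - 4 * p / 15 :=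
  idealFloor_handover_window hq hrq (ledger_of_idealFloor_comparison L hr hm hcmp)

/-- **Corner**: at `p = 2/51` the F7 comparison with `Λ_id` is refuted on the WHOLE typed range (`0 ≤ r`, `0 ≤ m`, `2r < q − m/2`, `q < 8/9`), at every `L ≥ 1`. -/
theorem idealFloor_comparison_false_corner (L : ℕ) [NeZero L] {q r m : ℝ} (hr : 0 ≤ r) (hm : 0 ≤ m) (hrq : 2 * r < q - m / 2) (hq : q < 8 / 9) :
    ¬ ∀ ε : ℝ, 0 < ε → ∃ β0 : ℝ, ∀ β : ℝ, β0 ≤ β →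
      riccatiN L β (powScale r β) (2 * powScale q β) (powScale m β) * Real.exp (-(6 * toronZPE L (1 / 2) 0 0)) ≤
        ((Real.exp (2 * β) * Real.sqrt (π / β) ^ 3 / (2 * π ^ 2)) ^ Fintype.card (Edge 3 L) *
            Real.exp (-(6 * toronZPE L (1 / 2) 0 0))) * Real.exp (ε * powScale (2 / 51) β) := by
  intro hcmp
  have h := (idealFloor_handover_window_of_comparison L hr hm hrq hq hcmp).1
  norm_num at h

/-- The point of record `(p, q, r, m) = (1/40, 0.85, 0.41, 0.055)` lies inside the window (`17p/3 + 2/3 = 97/120 < 0.85`, `0.391… < 0.41 < 0.431…`,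
`0.055 < 37/450 = 0.0822…`). -/
example : (1 : ℝ) / 40 < 2 / 51 ∧ (2 : ℝ) / 3 + 17 * (1 / 40) / 3 < 0.85 ∧ ((1 : ℝ) + 7 * (1 / 40)) / 3 < 0.41 ∧ (0.41 : ℝ) < 4 / 9 - (1 / 40) / 2 ∧
    (0.055 : ℝ) < 4 / 45 - 4 * (1 / 40) / 15 := by norm_num

end Summit.QuantumFields.YangMills.Theorems.TwistedTraceScaling.Negative.R14

end
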